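import Summits.KontsevichZagierPeriods.KontsevichZagierPeriods.Theses.FurushoPentagon
import Literature.NumberTheory.Transcendental.DrinfeldAssociatorRegularisation
import Literature.NumberTheory.Transcendental.AssociatorsPentagonWeightTwo

/-!
# `KernelModuloPeriodConjecture` (stmt-KontsevichZagierPeriods-15058), line `Sketch`: the pentagon
# hypothesis of the algebraic leaf is load-bearing

Cdisprove unit of the crux `KernelModuloPeriodConjecture` (route `FurushoPentagon`). The lead's line
`Sketch` rests on the registered stub `stub_associatorHoffmanSpanning` (the ALGEBRAIC LEAF
`AssociatorHoffmanSpanning`): for every admissible `s` one rational combination `b` of Hoffman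
indices of the same weight with `c_{binaryWord s}(φ) = Σ_t b_t c_{binaryWord t}(φ)` at every
group-like solution `φ` of Drinfeld's pentagon over every reduced commutative `ℚ`-algebra.

PROVED here: `stubA_false_without_pentagon` — the same statement with the hypothesis
`DrinfeldPentagon φ` DROPPED is FALSE already in weight 3. At `s = (2,1)` the only Hoffman index of
weight 3 is `(3)` (`eq_three_of_isHoffman_of_weight`), so a certificate is one rational `q` with
`c_{X₀X₁X₁}(φ) = q · c_{X₀X₀X₁}(φ)` for every group-like `φ`; the group-like series
`exp(X₀)exp(X₁)` and `exp(X₀)exp(2X₁)` in `ℚ⟨⟨X₀,X₁⟩⟩` (`Shuffle.isGroupLike_expLetter`,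
`NCSeries.IsGroupLike.mul`; coefficients `a²b/2` and `ab²/2`, `expXexpY_xxy`, `expXexpY_xyy`) force
`q = 1` and `q = 2`. (At pentagon solutions `q = −1`, the duality `ζ(2,1) = ζ(3)`:
`NCSeries.DrinfeldPentagon.apply_weight_three`.) Any proof of the leaf must use the pentagon beyond
group-likeness, i.e. beyond the shuffle relations.

Sources: C. Reutenauer, *Free Lie algebras* (1993), Thm 3.2; H. Furusho, Ann. of Math. 171 (2010),
§3; V. Drinfeld, Leningrad Math. J. 2 (1991).
-/

noncomputable section

namespace Summit.KontsevichZagierPeriods.KernelModuloPeriodConjecture.Negative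

open Literature.NumberTheory.Transcendental

/-- A Hoffman index of weight `3` is `(3)`. [folklore] -/
theorem eq_three_of_isHoffman_of_weight {t : List ℕ} (ht : MZV.IsHoffman t) (hw : MZV.weight t = 3) :
    t = [3] := by
  match t, ht, hw with
  | [], _, hw => simp [MZV.weight] at hw
  | [a], ht, hw =>
    have : a = 3 := by simpa [MZV.weight] using hw
    subst this; rfl
  | a :: b :: u, ht, hw =>
    exfalso
    have ha := ht a (by simp)
    have hb := ht b (by simp)
    have hw' : a + (b + u.sum) = 3 := by simpa [MZV.weight] using hw
    omega

/-- A `Finsupp.sum` whose support lies in `{t₀}` is the single term. [folklore] -/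
theorem finsupp_sum_eq_of_support_subset {M : Type*} [AddCommMonoid M] {b : List ℕ →₀ ℚ}
    {t₀ : List ℕ} (hb : ∀ t ∈ b.support, t = t₀) (g : List ℕ → ℚ → M) (hg : g t₀ 0 = 0) :
    b.sum g = g t₀ (b t₀) := by
  classical
  rw [Finsupp.sum_of_support_subset b (s := {t₀}) (fun t ht => Finset.mem_singleton.mpr (hb t ht))
    g (fun t ht => by rw [Finset.mem_singleton.mp ht]; exact hg)]
  exact Finset.sum_singleton _ _

/-- The two-parameter family of group-like series `exp(a X₀) exp(b X₁) ∈ ℚ⟨⟨X₀,X₁⟩⟩`. -/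
def expXexpY (a b : ℚ) : NCSeries Bool ℚ := Shuffle.expLetter false a * Shuffle.expLetter true b

/-- `exp(a X₀) exp(b X₁)` is group-like (exponentials of letters are group-like, and group-like
series form a group). [cite: Reutenauer1993, Thm 3.2] -/
theorem isGroupLike_expXexpY (a b : ℚ) : NCSeries.IsGroupLike (expXexpY a b) :=
  (Shuffle.isGroupLike_expLetter false a).mul (Shuffle.isGroupLike_expLetter true b)

/-- `c_{X₀X₀X₁}(exp(aX₀)exp(bX₁)) = a²b/2`. [folklore] -/
theorem expXexpY_xxy (a b : ℚ) : expXexpY a b [false, false, true] = a ^ 2 / 2 * b := by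
  simp [expXexpY, NCSeries.mul_apply_cons, NCSeries.mul_apply_nil', NCSeries.lderiv_apply,
    Shuffle.expLetter, List.replicate]
  left; ring

/-- `c_{X₀X₁X₁}(exp(aX₀)exp(bX₁)) = ab²/2`. [folklore] -/
theorem expXexpY_xyy (a b : ℚ) : expXexpY a b [false, true, true] = a * (b ^ 2 / 2) := by
  simp [expXexpY, NCSeries.mul_apply_cons, NCSeries.mul_apply_nil', NCSeries.lderiv_apply,
    Shuffle.expLetter, List.replicate]
  left; ring

/-- **`stubA_false_without_pentagon`: the pentagon hypothesis of the algebraic leaf is load-bearing.**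
The leaf with `DrinfeldPentagon φ` dropped — Hoffman reduction at every group-like series over every
reduced commutative `ℚ`-algebra — is false: at `s = (2,1)` the group-like series `exp(X₀)exp(X₁)`,
`exp(X₀)exp(2X₁)` over `ℚ` force the universal coefficient of `(3)` to be both `1` and `2`.
[folklore] -/
theorem stubA_false_without_pentagon :
    ¬ ∀ s : List ℕ, MZV.IsAdmissible s → ∃ b : List ℕ →₀ ℚ,
      (∀ t ∈ b.support, MZV.IsHoffman t ∧ MZV.weight t = MZV.weight s) ∧
      ∀ (R : Type) [CommRing R] [Algebra ℚ R] [IsReduced R] (φ : NCSeries Bool R),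
        NCSeries.IsGroupLike φ → φ (MZV.binaryWord s) = b.sum (fun t q => q • φ (MZV.binaryWord t)) := by
  intro h
  obtain ⟨b, hb, hφ⟩ := h [2, 1] ⟨by decide, by decide⟩
  have hsupp : ∀ t ∈ b.support, t = [3] := fun t ht =>
    eq_three_of_isHoffman_of_weight (hb t ht).1 (by simpa [MZV.weight] using (hb t ht).2)
  have key : ∀ φ : NCSeries Bool ℚ, NCSeries.IsGroupLike φ →
      φ [false, true, true] = b [3] * φ [false, false, true] := by
    intro φ hg
    have := hφ ℚ φ hg
    rw [finsupp_sum_eq_of_support_subset hsupp _ (by simp)] at this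
    simpa [MZV.binaryWord] using this
  have h₁ := key _ (isGroupLike_expXexpY 1 1)
  have h₂ := key _ (isGroupLike_expXexpY 1 2)
  rw [expXexpY_xxy, expXexpY_xyy] at h₁ h₂
  have hq : b [3] = 1 := by linarith
  rw [hq] at h₂
  norm_num at h₂

/-- For contrast: AT PENTAGON SOLUTIONS the weight-3 reduction holds with `q = −1` over every commutative
`ℚ`-algebra (the duality `ζ(2,1) = ζ(3)`; tree `NCSeries.DrinfeldPentagon.apply_weight_three`).
[cite: Furusho2010, §3] -/
theorem weightThree_reduction_of_pentagon {R : Type} [CommRing R] [Algebra ℚ R] {φ : NCSeries Bool R}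
    (hg : NCSeries.IsGroupLike φ) (h5 : NCSeries.DrinfeldPentagon φ) :
    φ (MZV.binaryWord [2, 1]) = (-1 : ℚ) • φ (MZV.binaryWord [3]) := by
  have hx := h5.apply_letter_eq_zero_of_isGroupLike hg false
  have hy := h5.apply_letter_eq_zero_of_isGroupLike hg true
  have h3 := h5.apply_weight_three hg.apply_nil hx hy
  show φ [false, true, true] = (-1 : ℚ) • φ [false, false, true]
  rw [neg_smul, one_smul]
  linear_combination h3

end Summit.KontsevichZagierPeriods.KernelModuloPeriodConjecture.Negative

end
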